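import Summits.QuantumFields.YangMills.Theorems.LuscherReductionDressedRitzPolyakovLiftGramUniversality
import Summits.QuantumFields.YangMills.Theorems.LuscherReductionDressedRitzLiftPositionCouplingSlowStiff
import HarnessLib

/-!
# Route `LuscherReduction`, item `DressedRitz` (stmt-QuantumFields-20205), line «polyakovlift» r5 — the one-site Gram core of S-STAT from AMPLITUDE
# BUDGETS: `ShadowAmplitudeAt k → PScalingGramAt k` (so that a ONE-type seat proves eigenvector-amplitude control and nothing else)

Support module (seat ym-infvol-p1 g6, holder of S-STAT `stub_liftStatics`; `--supports stmt-QuantumFields-20205`, helper).  In the crux map of record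
(LEAD, `CRUX-MAP-r5.md`, 15:20Z) S-STAT rests on ■ `GramUniversalityAt k` (RG) ∧ ■ `PScalingGramAt k` (ONE-type, one-site; both typed in
`…PolyakovLiftGramUniversality.lean`, p536411).  Parallel to the LEAD's plumbing of S-PSCAL (`pscalingExistsAt_of_shadowBudget`: ENERGY budgets of
the shadow vectors against an exact eigenfamily of `K_B` ⟹ (o5′)(o6′)), this file isolates what the one-site semiclassics must deliver for the
time-0 Gram clause (o2′) — AMPLITUDE budgets:

* `ShadowAmplitudeAt k` — in the ∀-basis one-site frame of `PScalingGramAt` (`Λ ∈ [lam, 2lam]`, `L ≥ L0`, every lift basis `(ω, g)` at `B₁ = 2/Λ³`,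
  every raw vacuum `e₀` of the `B = 2L³/Λ³` model), for each pair `i ≠ l` there are an exact `l2`-orthonormal physical eigenfamily `ψ` of `K_B` and a
  PRINCIPAL SET `S` of its indices such that the shadow vector `w_i` carries at most `CΛ²‖w_i‖²` of its mass OUTSIDE `S` (including the remainder
  `‖w_i − Σ_j ⟨w_i,ψ_j⟩ψ_j‖²`) and `w_l` carries at most `CΛ²‖w_l‖²` of its mass INSIDE `S` — i.e. `w_i` and `w_l` live, to relative amplitude `O(Λ)`,
  on ORTHOGONAL groups of `B`-model eigenvectors (their own levels' multiplets; cdisprove (G2-c): «shadow start vector = B-model eigenfunction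
  + O(Λ) in L²», dressing weights `O(1)`);
* `abs_l2_le_of_amplitude` — the abstract estimate: `|⟨u,v⟩| ≤ ‖u‖·√δ_v + 2√δ_u·‖v‖` from the polarised Parseval split (`bilin_split_eigenfamily`),
  Bessel, and Cauchy–Schwarz on `S`, on `Sᶜ` and on the remainders;
* ★ `pscalingGramAt_of_shadowAmplitude : ShadowAmplitudeAt k → PScalingGramAt k` (constant `3√C`).

WHY AMPLITUDE AND NOT ENERGY: an energy budget `Σ_j |ev_j − κ_i|⟨w_i,ψ_j⟩² ≲ (Λ²/L)κ_i‖w_i‖²` only confines `w_i` to its level up to relative amplitude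
`O(√Λ)` (level spacing `≍ (Λ/L)μ₀`), short of the `O(Λ)` of (o2′); the Gram clause needs first-order eigenvector control directly.  HONEST FRAMING:
Parseval ∕ Cauchy–Schwarz plumbing on the one-site lattice (conditional femto rung R2b1); `ShadowAmplitudeAt` is OPEN one-site semiclassics (L-sized,
numerically decidable); nothing here bears on infinite volume, the continuum limit or the Clay gap.  References: M. Lüscher, NPB 219 (1983) 233
[cite: Luscher1983, §3]; T. Kato (1966) §V.4 [cite: Kato1966, §V.4].
-/

set_option autoImplicit false

noncomputable section

open MeasureTheory Filter Topology Real
open Literature.MathematicalPhysics.QuantumFieldTheory (GaugeConfig Site gaugeTransform)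
open scoped BigOperators

namespace Summit.QuantumFields.YangMills.Theorems.FemtoTransferGap.PolyakovLift

open Summit.QuantumFields.YangMills.Theorems.FemtoTransferGap
open Summit.QuantumFields.YangMills.Theorems.FemtoTransferGap.LiftPos

/-! ## §1 The amplitude budget, typed -/

/-- **`ShadowAmplitudeAt k`** — what the one-site semiclassics must prove for the Gram clause (o2′): in the frame of `PScalingGramAt` (every lift basis
`(ω, g)` at `B₁ = 2/Λ³`, every raw vacuum `e₀` of the `B = 2L³/Λ³` model, `Λ ∈ [lam, 2lam]`, `L ≥ L0`), for each pair `i ≠ l` there are an exact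
`l2`-orthonormal physical eigenfamily `ψ` of `K_B` and a principal index set `S` with
`Σ_{j ∉ S} ⟨w_i,ψ_j⟩² + ‖w_i − Σ_j⟨w_i,ψ_j⟩ψ_j‖² ≤ CΛ²‖w_i‖²` and `Σ_{j ∈ S} ⟨w_l,ψ_j⟩² ≤ CΛ²‖w_l‖²`, `w = shadowFamily B L e₀ g`. [cite: Luscher1983, §3] [cite: Kato1966, §V.4] -/
def ShadowAmplitudeAt (k : ℕ) : Prop :=
  ∃ C lam0 : ℝ, 0 ≤ C ∧ 0 < lam0 ∧ ∀ lam : ℝ, 0 < lam → lam ≤ lam0 → ∃ L0 : ℕ, ∀ L : ℕ, L0 ≤ L →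
    ∀ Λ : ℝ, lam ≤ Λ → Λ ≤ 2 * lam →
      ∀ (ω : GaugeConfig 3 1 SU2 → ℝ) (g : Fin k → (GaugeConfig 3 1 SU2 → ℝ)), LiftBasis (2 / Λ ^ 3) k ω g →
        ∀ e₀ : GaugeConfig 3 1 SU2 → ℝ, IsRawVacuum (L := 1) (2 * (L : ℝ) ^ 3 / Λ ^ 3) e₀ →
          let B : ℝ := 2 * (L : ℝ) ^ 3 / Λ ^ 3
          let w : Fin k → (GaugeConfig 3 1 SU2 → ℝ) := shadowFamily B L e₀ g
          ∀ i l : Fin k, i ≠ l → ∃ (N : ℕ) (ψ : Fin N → (GaugeConfig 3 1 SU2 → ℝ)) (ev : Fin N → ℝ) (S : Finset (Fin N)),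
            (∀ j, IsPhys (ψ j)) ∧ (∀ j j', l2 (ψ j) (ψ j') = if j = j' then 1 else 0) ∧
            (∀ j, transferApply B (ψ j) = ev j • ψ j) ∧
            (∑ j ∈ Sᶜ, l2 (w i) (ψ j) ^ 2 + l2 (w i - ∑ j, l2 (w i) (ψ j) • ψ j) (w i - ∑ j, l2 (w i) (ψ j) • ψ j) ≤ C * Λ ^ 2 * l2 (w i) (w i)) ∧
            (∑ j ∈ S, l2 (w l) (ψ j) ^ 2 ≤ C * Λ ^ 2 * l2 (w l) (w l))

/-! ## §2 The abstract estimate: orthogonal principal groups ⟹ small inner product -/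

section Estimate

variable {L : ℕ} [NeZero L]

/-- Cauchy–Schwarz over a finset in square-root form: `|Σ_{j∈s} a_j b_j| ≤ √(Σ_{j∈s} a_j²)·√(Σ_{j∈s} b_j²)`. [folklore] -/
theorem abs_sum_mul_le_sqrt_mul_sqrt {N : ℕ} (s : Finset (Fin N)) (a b : Fin N → ℝ) :
    |∑ j ∈ s, a j * b j| ≤ Real.sqrt (∑ j ∈ s, a j ^ 2) * Real.sqrt (∑ j ∈ s, b j ^ 2) := by
  rw [← Real.sqrt_mul (Finset.sum_nonneg fun j _ => sq_nonneg (a j)), ← Real.sqrt_sq_eq_abs]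
  exact Real.sqrt_le_sqrt (Finset.sum_mul_sq_le_sq_mul_sq s a b)

/-- ★ **Amplitude estimate.**  For an exact `l2`-orthonormal physical eigenfamily `ψ` of `K_β`, physical `u, v`, a finset `S` of indices and budgets
`Σ_{j∉S}⟨u,ψ_j⟩² + ‖r_u‖² ≤ δ_u`, `Σ_{j∈S}⟨v,ψ_j⟩² ≤ δ_v` (`r = · − Σ_j⟨·,ψ_j⟩ψ_j`): `|⟨u,v⟩| ≤ √⟨u,u⟩·√δ_v + 2·√δ_u·√⟨v,v⟩`
(Parseval split `⟨u,v⟩ = Σ_j a_j b_j + ⟨r_u,r_v⟩`, Bessel `Σ a_j² ≤ ‖u‖²`, `‖r_v‖ ≤ ‖v‖`, Cauchy–Schwarz on `S`, `Sᶜ`, remainders). [cite: Kato1966, §V.4] -/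
theorem abs_l2_le_of_amplitude (β : ℝ) {N : ℕ} {ψ : Fin N → (GaugeConfig 3 L SU2 → ℝ)} (hψ : ∀ j, IsPhys (ψ j))
    (hon : ∀ j j', l2 (ψ j) (ψ j') = if j = j' then 1 else 0) (ev : Fin N → ℝ) (heig : ∀ j, transferApply β (ψ j) = ev j • ψ j)
    {u v : GaugeConfig 3 L SU2 → ℝ} (hu : IsPhys u) (hv : IsPhys v) (S : Finset (Fin N)) {δu δv : ℝ}
    (hδu : ∑ j ∈ Sᶜ, l2 u (ψ j) ^ 2 + l2 (u - ∑ j, l2 u (ψ j) • ψ j) (u - ∑ j, l2 u (ψ j) • ψ j) ≤ δu)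
    (hδv : ∑ j ∈ S, l2 v (ψ j) ^ 2 ≤ δv) :
    |l2 u v| ≤ Real.sqrt (l2 u u) * Real.sqrt δv + 2 * (Real.sqrt δu * Real.sqrt (l2 v v)) := by
  classical
  -- Parseval splits
  obtain ⟨huv, -⟩ := bilin_split_eigenfamily β hψ hon ev heig hu hv
  obtain ⟨huu, -⟩ := bilin_split_eigenfamily β hψ hon ev heig hu hu
  obtain ⟨hvv, -⟩ := bilin_split_eigenfamily β hψ hon ev heig hv hv
  set a : Fin N → ℝ := fun j => l2 u (ψ j) with ha
  set b : Fin N → ℝ := fun j => l2 v (ψ j) with hb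
  set ru := u - ∑ j, l2 u (ψ j) • ψ j with hru
  set rv := v - ∑ j, l2 v (ψ j) • ψ j with hrv
  have hruP : IsPhys ru := isPhys_remainder hψ hu
  have hrvP : IsPhys rv := isPhys_remainder hψ hv
  have hru0 : 0 ≤ l2 ru ru := l2_self_nonneg _
  have hrv0 : 0 ≤ l2 rv rv := l2_self_nonneg _
  have hsumsq_u : ∑ j, a j ^ 2 = ∑ j, a j * a j := Finset.sum_congr rfl fun j _ => sq (a j)
  have hsumsq_v : ∑ j, b j ^ 2 = ∑ j, b j * b j := Finset.sum_congr rfl fun j _ => sq (b j)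
  -- norms: ‖u‖² = Σ a² + ‖r_u‖², ‖v‖² = Σ b² + ‖r_v‖²
  have huu' : l2 u u = ∑ j, a j ^ 2 + l2 ru ru := by rw [hsumsq_u]; exact huu
  have hvv' : l2 v v = ∑ j, b j ^ 2 + l2 rv rv := by rw [hsumsq_v]; exact hvv
  have ha2 : 0 ≤ ∑ j, a j ^ 2 := Finset.sum_nonneg fun j _ => sq_nonneg _
  have hb2 : 0 ≤ ∑ j, b j ^ 2 := Finset.sum_nonneg fun j _ => sq_nonneg _
  -- split the coefficient sum over `S` and `Sᶜ`
  have hsplit : ∑ j, a j * b j = ∑ j ∈ S, a j * b j + ∑ j ∈ Sᶜ, a j * b j :=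
    (Finset.sum_add_sum_compl S fun j => a j * b j).symm
  have hS_a : ∑ j ∈ S, a j ^ 2 ≤ l2 u u := by
    calc ∑ j ∈ S, a j ^ 2 ≤ ∑ j, a j ^ 2 := Finset.sum_le_univ_sum_of_nonneg fun j => sq_nonneg (a j)
      _ ≤ l2 u u := by rw [huu']; linarith
  have hSc_b : ∑ j ∈ Sᶜ, b j ^ 2 ≤ l2 v v := by
    calc ∑ j ∈ Sᶜ, b j ^ 2 ≤ ∑ j, b j ^ 2 := Finset.sum_le_univ_sum_of_nonneg fun j => sq_nonneg (b j)
      _ ≤ l2 v v := by rw [hvv']; linarith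
  have hSc_a : ∑ j ∈ Sᶜ, a j ^ 2 ≤ δu := by linarith [hδu]
  have hru_le : l2 ru ru ≤ δu := by
    have : 0 ≤ ∑ j ∈ Sᶜ, a j ^ 2 := Finset.sum_nonneg fun j _ => sq_nonneg _
    linarith [hδu]
  have hrv_le : l2 rv rv ≤ l2 v v := by rw [hvv']; linarith
  -- the three pieces
  have h1 : |∑ j ∈ S, a j * b j| ≤ Real.sqrt (l2 u u) * Real.sqrt δv :=
    (abs_sum_mul_le_sqrt_mul_sqrt S a b).trans
      (mul_le_mul (Real.sqrt_le_sqrt hS_a) (Real.sqrt_le_sqrt hδv) (Real.sqrt_nonneg _) (Real.sqrt_nonneg _))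
  have h2 : |∑ j ∈ Sᶜ, a j * b j| ≤ Real.sqrt δu * Real.sqrt (l2 v v) :=
    (abs_sum_mul_le_sqrt_mul_sqrt Sᶜ a b).trans
      (mul_le_mul (Real.sqrt_le_sqrt hSc_a) (Real.sqrt_le_sqrt hSc_b) (Real.sqrt_nonneg _) (Real.sqrt_nonneg _))
  have h3 : |l2 ru rv| ≤ Real.sqrt δu * Real.sqrt (l2 v v) := by
    have hcs : |l2 ru rv| ≤ Real.sqrt (l2 ru ru) * Real.sqrt (l2 rv rv) := by
      rw [← Real.sqrt_mul hru0, ← Real.sqrt_sq_eq_abs]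
      exact Real.sqrt_le_sqrt (by simpa [sq] using sq_l2_le hruP hrvP)
    exact hcs.trans (mul_le_mul (Real.sqrt_le_sqrt hru_le) (Real.sqrt_le_sqrt hrv_le) (Real.sqrt_nonneg _) (Real.sqrt_nonneg _))
  -- assemble
  rw [huv, hsplit]
  calc |∑ j ∈ S, a j * b j + ∑ j ∈ Sᶜ, a j * b j + l2 ru rv|
      ≤ |∑ j ∈ S, a j * b j| + |∑ j ∈ Sᶜ, a j * b j| + |l2 ru rv| := by
        calc _ ≤ |∑ j ∈ S, a j * b j + ∑ j ∈ Sᶜ, a j * b j| + |l2 ru rv| := abs_add_le _ _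
          _ ≤ _ := by linarith [abs_add_le (∑ j ∈ S, a j * b j) (∑ j ∈ Sᶜ, a j * b j)]
    _ ≤ Real.sqrt (l2 u u) * Real.sqrt δv + Real.sqrt δu * Real.sqrt (l2 v v) + Real.sqrt δu * Real.sqrt (l2 v v) := by
        linarith [h1, h2, h3]
    _ = Real.sqrt (l2 u u) * Real.sqrt δv + 2 * (Real.sqrt δu * Real.sqrt (l2 v v)) := by ring

end Estimate

/-! ## §3 ★ The composition: amplitude budgets ⟹ the one-site Gram core (o2′) -/

/-- ★★ **`ShadowAmplitudeAt k → PScalingGramAt k`** (constant `3√C`): read the amplitude budgets of the pair `(i, l)`, apply `abs_l2_le_of_amplitude` with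
`δ_u = CΛ²‖w_i‖²`, `δ_v = CΛ²‖w_l‖²`, and pull `√(CΛ²) = √C·Λ` out of the square roots. [cite: Luscher1983, §3] -/
theorem pscalingGramAt_of_shadowAmplitude {k : ℕ} (h : ShadowAmplitudeAt k) : PScalingGramAt k := by
  obtain ⟨C, lam0, hC, hlam0, hk⟩ := h
  refine ⟨3 * Real.sqrt C, lam0, by positivity, hlam0, fun lam hlam hle => ?_⟩
  obtain ⟨L0, hL⟩ := hk lam hlam hle
  refine ⟨L0, fun L hL0 Λ hlo hhi ω g hbasis e₀ he₀ i l hil => ?_⟩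
  have hΛ : 0 < Λ := hlam.trans_le hlo
  obtain ⟨N, ψ, ev, S, hψ, hon, heig, hbi, hbl⟩ := hL L hL0 Λ hlo hhi ω g hbasis e₀ he₀ i l hil
  set B : ℝ := 2 * (L : ℝ) ^ 3 / Λ ^ 3 with hBdef
  set w : Fin k → (GaugeConfig 3 1 SU2 → ℝ) := shadowFamily B L e₀ g with hwdef
  have hg : ∀ i, IsPhys (g i) := hbasis.2.2.2.2.1
  have hw : ∀ i, IsPhys (w i) := fun i => by
    simp only [hwdef, shadowFamily, shadowVec]
    exact isPhys_iterate_transferApply B (OpPlat.isPhys_ins he₀.1 (isPhys_comp_powLink L (hg i))) _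
  have hest := abs_l2_le_of_amplitude B hψ hon ev heig (hw i) (hw l) S hbi hbl
  have hni : 0 ≤ l2 (w i) (w i) := l2_self_nonneg _
  have hnl : 0 ≤ l2 (w l) (w l) := l2_self_nonneg _
  have hsq : ∀ {n : ℝ}, 0 ≤ n → Real.sqrt (C * Λ ^ 2 * n) = Real.sqrt C * Λ * Real.sqrt n := fun {n} hn => by
    rw [Real.sqrt_mul (mul_nonneg hC (sq_nonneg Λ)), Real.sqrt_mul hC, Real.sqrt_sq hΛ.le]
  rw [hsq hni, hsq hnl] at hest
  calc |l2 (w i) (w l)| ≤ Real.sqrt (l2 (w i) (w i)) * (Real.sqrt C * Λ * Real.sqrt (l2 (w l) (w l))) +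
        2 * (Real.sqrt C * Λ * Real.sqrt (l2 (w i) (w i)) * Real.sqrt (l2 (w l) (w l))) := hest
    _ = 3 * Real.sqrt C * Λ * (Real.sqrt (l2 (w i) (w i)) * Real.sqrt (l2 (w l) (w l))) := by ring

/-- The full one-site half of S-STAT's split, from amplitude budgets: `ShadowAmplitudeAt` at every level gives `PScalingGramAt` at every level, hence
(with the RG half `GramUniversalityAt`) the registered text `LiftStaticsR3` by `liftStaticsR3_of_gramUniversality_pscalingGram`. [cite: Luscher1983, §3] -/
theorem liftStaticsR3_of_gramUniversality_shadowAmplitude (hA : ∀ k, GramUniversalityAt k) (hB : ∀ k, ShadowAmplitudeAt k) :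
    LiftStaticsR3 :=
  liftStaticsR3_of_gramUniversality_pscalingGram hA fun k => pscalingGramAt_of_shadowAmplitude (hB k)

end Summit.QuantumFields.YangMills.Theorems.FemtoTransferGap.PolyakovLift

end
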